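import Summits.CriticalPhenomena.PercolationContinuityZ3.Theorems.PercNearOneGluingNoHeavyLowerTailSunflowerWeightedSafe
import HarnessLib
import HarnessLib.Audit

/-!
# `NoHeavyLowerTail` (crux stmt-CriticalPhenomena-4575), abstract sunflower cubic: LAYERED AND SINGLE-VERTEX CONDITIONING —
# the termwise weighted inequality as a GENERAL route to `TriangleFreeSafe`, its proved base case, and the odd cycles

Support file (seat `prim-ineq-prove-1` gen 71; `--supports stmt-CriticalPhenomena-4575`).  No `sorry`, no named facts.  The two
`@[conjecture]` definitions are obligations of this programme (census-true, unproved), used only as explicit hypotheses.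
Memo: run/shared/lean/prim/prim-ineq-prove-1/FINDING-LAYERED-prove1-g71.md.

Gen 40 proved the weighted (symmetrised polarised) inequality TERMWISE for the conditioning on one side `L` of a bipartite graph
(`weighted_of_bipartite`), gen 70 isolated `TermWeightedIneq Γ L` (the weighted inequality on every fibre of the restriction `resL L`)
and found by exact census that for the odd cycle `C_n` it holds for `L = {3, 5, …, n−2}` (`OddCycleTermWeighted`) and FAILS for every
conditioned set containing an edge or both neighbours of the "defect".  This file records the criterion behind that census and its
consequences:

* `Layered Γ A` — `A` is independent AND the set `N(A) ∖ A` of "typed" vertices is independent (no edge of `Γ − A` joins two vertices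
  that both have a neighbour in `A`).  **`LayeredTermWeighted`** (typed conjecture): for triangle-free `Γ` and layered `A`,
  `TermWeightedIneq Γ A`.  CENSUS (gen 70 memo §2–§3 + this work, exact, no failing term): every layered set tested — `C₅…C₁₁` with
  `A = {3,…,n−2}` (gen 70), `C₅`/`C₇` with `A = {3}`, `C₆`/`P₅`/`P₆`/`P₇` with layered `A`, `Q₃`, `K_{3,3}`, `C₅ + pendant` and
  `C₅ + (vertex ∼ 0, 2)` (every vertex orbit), `C₅` + pendant path / + handle, `C₇ + pendant`, `C₉ + chord`, two `C₅`'s sharing a vertex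
  (non-singleton layered sets of non-bipartite graphs), `M₈ = And₃` with `A = {v}`; mostly `K = 3`, `C₅` up to `K = 5` — and EVERY
  non-layered set tested fails (`C₅` `{1,3}`, `C₆` `{0,3}`, `C₇` `{1,3,5}`, `{0,3}`, `{0,1,3}`, `C₅ + vertex` `{1,4,5}`, …); Petersen,
  Grötzsch, `X₈`, `C₉`/`C₁₁` with `A = {3}` and `M₈` at `K = 4` are kit job j306819, pending at the time of writing (memo §5).
  Its case `N(A) ∖ A = everything else` (no typeless vertex) is exactly gen 40's theorem:
  **`termWeightedIneq_of_bipartite`** (proved here, the per-term form of `weighted_of_bipartite`) with `layered_of_bipartite`.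
* `SingleVertexTermWeighted` (typed conjecture): `TermWeightedIneq Γ {v}` for every vertex of a triangle-free graph — the instance
  `A = {v}` of the previous one (`layered_singleton`: `N(v)` is independent iff no triangle at `v`), hence
  **`triangleFreeSafe_of_singleVertex : SingleVertexTermWeighted → SafeCalc.TriangleFreeSafe`** (g39's conjecture "every
  triangle-free graph core is A-safe", via `safe_edgeCore_of_weightedIneq`); and `triangleFreeSafe_of_layered`.
* the odd cycles: `layered_oddCond` (gen 70's conditioned set is layered), `cycleGraph_cliqueFree_three`, hence
  **`oddCycleTermWeighted_of_layered : LayeredTermWeighted → OddCycleTermWeighted`**.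
-/

namespace Summit.CriticalPhenomena.PercolationContinuityZ3.Theorems.SunflowerPartition

namespace Bridge

open Finset MeasureTheory Literature.Probability.LatticeModels Literature.Probability.Percolation

variable {K n : ℕ}

/-! ### Layered conditioning sets and the two typed conjectures -/

/-- **Layered conditioning set**: `A` is independent and the "typed" vertices (those outside `A` with a neighbour in `A`) are
pairwise non-adjacent — equivalently every edge of `Γ − A` has an endpoint with no neighbour in `A` ("typeless").  For a
bipartition side `A = L` there is no typeless vertex (gen 40's setting); for the odd cycle and `A = {3,5,…,n−2}` the typeless
vertices are `0, 1` (gen 70's "gadget" `n−1 – 0 – 1 – 2`); for `A = {v}` the condition says `N(v)` is independent. [this work] -/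
def Layered (Γ : SimpleGraph (Fin n)) (A : Finset (Fin n)) : Prop :=
  (∀ u ∈ A, ∀ v ∈ A, ¬ Γ.Adj u v) ∧
    ∀ u v, u ∉ A → v ∉ A → (∃ a ∈ A, Γ.Adj a u) → (∃ a ∈ A, Γ.Adj a v) → ¬ Γ.Adj u v

/-- **TYPED CONJECTURE (`LayeredTermWeighted`).**  For every triangle-free graph and every layered conditioning set `A`, the weighted
(symmetrised polarised) inequality `Σ_{BAD} (K − |J|)! ≤ (K−1)!·#GOOD` holds on every term (every fibre of `resL A`):
`TermWeightedIneq Γ A`.  Census-true on everything tested (file docstring); the case without typeless vertices is the theorem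
`termWeightedIneq_of_bipartite`; it implies `OddCycleTermWeighted` (`oddCycleTermWeighted_of_layered`) and `TriangleFreeSafe`
(`triangleFreeSafe_of_layered`).  An obligation of this programme, never used as a fact. [conjecture, this work] -/
@[conjecture] def LayeredTermWeighted : Prop :=
  ∀ (n : ℕ) (Γ : SimpleGraph (Fin n)) (A : Finset (Fin n)), Γ.CliqueFree 3 → Layered Γ A → TermWeightedIneq Γ A

/-- **TYPED CONJECTURE (`SingleVertexTermWeighted`).**  For every triangle-free graph and every vertex `v`, the weighted inequality
holds on every fibre of "which rows contain `v`": `TermWeightedIneq Γ {v}`.  The instance `A = {v}` of `LayeredTermWeighted`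
(`singleVertex_of_layered`); it implies g39's conjecture `TriangleFreeSafe` (`triangleFreeSafe_of_singleVertex`).  Census (exact, this
work, no failing term): `C₅` (`K ≤ 5`), `C₇`, `C₆`, `Q₃`, `K_{3,3}`, `C₅ + pendant` and `C₅ + (vertex ∼ 0, 2)` (every vertex orbit; the
new vertex also at `K = 4`), `M₈ = And₃` (`K = 3`, 10 petal systems); Petersen, Grötzsch, `X₈`, `C₉`, `C₁₁`, `M₈` at `K = 4`: kit job
j306819, pending at the time of writing (memo §5).  An obligation of this programme, never used as a fact. [conjecture, this work] -/
@[conjecture] def SingleVertexTermWeighted : Prop :=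
  ∀ (n : ℕ) (Γ : SimpleGraph (Fin n)) (v : Fin n), Γ.CliqueFree 3 → TermWeightedIneq Γ {v}

/-- In a triangle-free graph every singleton is a layered conditioning set (`N(v)` is independent). [this work] -/
theorem layered_singleton (Γ : SimpleGraph (Fin n)) (hΓ : Γ.CliqueFree 3) (v : Fin n) : Layered Γ {v} := by
  refine ⟨fun u hu w hw => ?_, fun u w _ _ hu hw huw => ?_⟩
  · rw [Finset.mem_singleton] at hu hw
    rw [hu, hw]
    exact Γ.irrefl
  · obtain ⟨a, ha, hau⟩ := hu
    obtain ⟨b, hb, hbw⟩ := hw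
    rw [Finset.mem_singleton] at ha hb
    rw [ha] at hau
    rw [hb] at hbw
    exact hΓ {v, u, w} (SimpleGraph.is3Clique_triple_iff.2 ⟨hau, hbw, huw⟩)

/-- `LayeredTermWeighted` implies `SingleVertexTermWeighted`. [this work] -/
theorem singleVertex_of_layered (h : LayeredTermWeighted) : SingleVertexTermWeighted :=
  fun n Γ v hΓ => h n Γ {v} hΓ (layered_singleton Γ hΓ v)

/-- **`SingleVertexTermWeighted` implies g39's conjecture `TriangleFreeSafe`** (every triangle-free graph core is A-safe for every
parameter vector): sum the termwise inequality over the terms (`weightedIneq_of_termWeightedIneq`) and apply the gen-40 assembly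
`safe_edgeCore_of_weightedIneq`; the empty graph is bipartite. [this work] -/
theorem triangleFreeSafe_of_singleVertex (h : SingleVertexTermWeighted) : SafeCalc.TriangleFreeSafe := by
  intro n Γ hΓ p
  rcases Nat.eq_zero_or_pos n with hn | hn
  · subst hn
    exact safe_edgeCore_of_isBipartite Γ (SimpleGraph.Colorable.of_isEmpty 2) p
  · set v : Fin n := ⟨0, hn⟩ with hv
    have hT : TermWeightedIneq Γ {v} := h n Γ v hΓ
    have hW : WeightedIneq Γ := weightedIneq_of_termWeightedIneq Γ {v} hT
    exact safe_edgeCore_of_weightedIneq Γ hW p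

/-- `LayeredTermWeighted` implies `TriangleFreeSafe`. [this work] -/
theorem triangleFreeSafe_of_layered (h : LayeredTermWeighted) : SafeCalc.TriangleFreeSafe :=
  triangleFreeSafe_of_singleVertex (singleVertex_of_layered h)

/-! ### Coarser conditionings follow from finer ones -/

/-- Restricting to a smaller conditioned set factors through the larger one. -/
theorem resL_resL_of_subset {A B : Finset (Fin n)} (hBA : B ⊆ A) (S : Fin n → Finset (Fin K)) :
    resL B (resL A S) = resL B S := by
  funext x
  unfold resL
  by_cases hx : x ∈ B
  · simp [hx, hBA hx]
  · simp [hx]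

open scoped Classical in
/-- **Anti-monotonicity of the termwise inequality**: if the weighted inequality holds on every term of the conditioning by `A`, it holds on
every term of the coarser conditioning by `B ⊆ A` (each `B`-term is a disjoint union of `A`-terms).  With `B = ∅` this is
`weightedIneq_of_termWeightedIneq`; for the odd cycle it takes gen 70's `A = {3, 5, …, n−2}` down to the single vertex `{3}`. [this work] -/
theorem termWeightedIneq_anti (Γ : SimpleGraph (Fin n)) {A B : Finset (Fin n)} (hBA : B ⊆ A)
    (hT : TermWeightedIneq Γ A) : TermWeightedIneq Γ B := by
  classical
  intro K V hV hcap m S₀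
  set E := SafeCalc.edgeCore Γ with hE
  set C := (TypeModel.Model.confs (ι := Fin n) (K := K) m).filter fun S => resL B S = resL B S₀ with hC
  set keys := C.image (resL A) with hkeys
  have hmaps : ∀ S ∈ C, resL A S ∈ keys := fun S hS => Finset.mem_image_of_mem _ hS
  -- an `A`-fibre through a point of `C` lies inside `C`
  have hfib : ∀ S₁ ∈ C, (C.filter fun S => resL A S = resL A S₁) =
      ((TypeModel.Model.confs m).filter fun S => resL A S = resL A S₁) := by
    intro S₁ hS₁
    rw [hC, Finset.mem_filter] at hS₁
    ext S
    simp only [hC, Finset.mem_filter]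
    constructor
    · rintro ⟨⟨hS, -⟩, h⟩; exact ⟨hS, h⟩
    · rintro ⟨hS, h⟩
      refine ⟨⟨hS, ?_⟩, h⟩
      rw [← resL_resL_of_subset hBA S, h, resL_resL_of_subset hBA, hS₁.2]
  have lhs : ∑ S ∈ C.filter (fun S => BadG E (Wof Γ V) S), (K - (J E S).card).factorial =
      ∑ SL ∈ keys, ∑ S ∈ (C.filter fun S => resL A S = SL),
        (if BadG E (Wof Γ V) S then (K - (J E S).card).factorial else 0) := by
    rw [Finset.sum_filter, ← Finset.sum_fiberwise_of_maps_to hmaps]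
  have rhs : ((C.filter fun S => GoodG E (Wof Γ V) S).card : ℕ) =
      ∑ SL ∈ keys, ((C.filter fun S => resL A S = SL).filter fun S => GoodG E (Wof Γ V) S).card := by
    rw [Finset.card_filter, ← Finset.sum_fiberwise_of_maps_to hmaps]
    refine Finset.sum_congr rfl fun SL _ => ?_
    rw [Finset.card_filter]
  rw [lhs, rhs, Finset.mul_sum]
  refine Finset.sum_le_sum fun SL hSL => ?_
  obtain ⟨S₁, hS₁, rfl⟩ := Finset.mem_image.1 hSL
  rw [hfib S₁ hS₁]
  have h := hT K V hV hcap m S₁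
  rw [Finset.sum_filter] at h
  exact h

/-! ### The proved base case: no typeless vertex (gen 40) -/

/-- A bipartition side is a layered conditioning set (with no typeless vertex). [this work] -/
theorem layered_of_bipartite (Γ : SimpleGraph (Fin n)) (L : Finset (Fin n)) (hL : ∀ u v, Γ.Adj u v → (u ∈ L ↔ v ∉ L)) :
    Layered Γ L := by
  refine ⟨fun u hu v hv huv => ((hL u v huv).1 hu) hv, fun u v hu hv _ _ huv => ?_⟩
  exact hu ((hL u v huv).2 hv)

open scoped Classical in
/-- **The base case of `LayeredTermWeighted` (gen 40, termwise form).**  For one side `L` of a bipartition the weighted inequality holds on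
every term: the fibre of `resL L` over a key is the injective `glue`-image of the R-configurations (`fibre_eq_image`), on which the
type-model lemma for `modelOf` applies (`bad_of_badG`, `nonA_modelOf_eq_J`, `goodG_of_good`) — the summand of `weighted_of_bipartite`.
[this work] -/
theorem termWeightedIneq_of_bipartite (Γ : SimpleGraph (Fin n)) (L : Finset (Fin n))
    (hL : ∀ u v, Γ.Adj u v → (u ∈ L ↔ v ∉ L)) : TermWeightedIneq Γ L := by
  classical
  intro K V hV hcap m S₀
  have H : Hyp Γ L V := ⟨hL, hV, hcap⟩
  set C := TypeModel.Model.confs (ι := Fin n) (K := K) m with hC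
  by_cases hne : ((C.filter fun S => resL L S = resL L S₀)).Nonempty
  swap
  · rw [Finset.not_nonempty_iff_eq_empty] at hne
    rw [hne]; simp
  obtain ⟨S₁, hS₁⟩ := hne
  rw [Finset.mem_filter] at hS₁
  have hfib : (C.filter fun S => resL L S = resL L S₀) = (C.filter fun S => resL L S = resL L S₁) := by
    rw [hS₁.2]
  rw [hfib, Finset.sum_filter, fibre_eq_image L m hS₁.1]
  set SL := resL L S₁
  set M := modelOf Γ L V SL H with hM
  set CR := TypeModel.Model.confs (K := K) (fun x : Rv L => m x.1) with hCR
  have hinj := glue_injective L SL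
  rw [Finset.sum_image (fun T _ T' _ h => hinj h)]
  rw [Finset.filter_image, Finset.card_image_of_injective _ hinj]
  have step1 : ∑ T ∈ CR, (if BadG (SafeCalc.edgeCore Γ) (Wof Γ V) (glue L SL T) then
        (K - (J (SafeCalc.edgeCore Γ) (glue L SL T)).card).factorial else 0) ≤
      ∑ T ∈ CR.filter (fun T => M.Bad T), (K - (M.nonA T).card).factorial := by
    rw [Finset.sum_filter]
    refine Finset.sum_le_sum fun T _ => ?_
    by_cases hb : BadG (SafeCalc.edgeCore Γ) (Wof Γ V) (glue L SL T)
    · have hB : M.Bad T := bad_of_badG Γ L V SL H hb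
      rw [if_pos hb, if_pos hB, nonA_modelOf_eq_J Γ L V SL H T]
    · rw [if_neg hb]; exact Nat.zero_le _
  have step2 := M.typeModel_lemma (fun x : Rv L => m x.1)
  have step3 : (CR.filter fun T => M.Good T).card ≤
      (CR.filter fun T => GoodG (SafeCalc.edgeCore Γ) (Wof Γ V) (glue L SL T)).card :=
    Finset.card_le_card (Finset.monotone_filter_right _ fun T _ hg => goodG_of_good Γ L V SL H hg)
  calc ∑ T ∈ CR, (if BadG (SafeCalc.edgeCore Γ) (Wof Γ V) (glue L SL T) then
          (K - (J (SafeCalc.edgeCore Γ) (glue L SL T)).card).factorial else 0)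
      ≤ ∑ T ∈ CR.filter (fun T => M.Bad T), (K - (M.nonA T).card).factorial := step1
    _ ≤ (K - 1).factorial * (CR.filter fun T => M.Good T).card := step2
    _ ≤ (K - 1).factorial * (CR.filter fun T => GoodG (SafeCalc.edgeCore Γ) (Wof Γ V) (glue L SL T)).card :=
        Nat.mul_le_mul_left _ step3

/-- **The case of `LayeredTermWeighted` WITHOUT TYPELESS VERTICES is a theorem**: if `A` is layered and every vertex outside `A` has a
neighbour in `A`, then `A` is one side of a bipartition of `Γ` (an edge `u v` with `u ∉ A` forces `v ∈ A`, since two typed vertices are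
never adjacent) and the termwise inequality is gen 40's `termWeightedIneq_of_bipartite`.  The open part of the conjecture is therefore
exactly the handling of typeless vertices (for the odd cycle: the two middle vertices `0, 1` of gen 70's gadget). [this work] -/
theorem termWeightedIneq_of_layered_of_forall_exists_adj (Γ : SimpleGraph (Fin n)) (A : Finset (Fin n)) (hA : Layered Γ A)
    (hall : ∀ u, u ∉ A → ∃ a ∈ A, Γ.Adj a u) : TermWeightedIneq Γ A :=
  termWeightedIneq_of_bipartite Γ A fun u v huv =>
    ⟨fun hu hv => hA.1 u hu v hv huv, fun hv => by
      by_contra hu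
      exact hA.2 u v hu hv (hall u hu) (hall v hv) huv⟩

/-- Hence every conditioning set CONTAINED IN one side of a bipartition satisfies the termwise inequality (anti-monotonicity); e.g. a layered
set together with its typeless vertices when these form an independent set not adjacent to `A`.  The conjecture is new only when the typeless
vertices span an edge (odd cycles: the edge `0 – 1`) or `A` meets both sides of a bipartite graph. [this work] -/
theorem termWeightedIneq_of_subset_side (Γ : SimpleGraph (Fin n)) {A L : Finset (Fin n)} (hAL : A ⊆ L)
    (hL : ∀ u v, Γ.Adj u v → (u ∈ L ↔ v ∉ L)) : TermWeightedIneq Γ A :=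
  termWeightedIneq_anti Γ hAL (termWeightedIneq_of_bipartite Γ L hL)

/-! ### The odd cycles: gen 70's conditioned set is layered -/

/-- Adjacency in the cycle `C_N` (`N ≥ 3`) by labels: consecutive labels or the closing edge `{0, N−1}`. [this work] -/
theorem cycleGraph_adj_iff_val_succ {N : ℕ} (hN : 3 ≤ N) (u v : Fin N) :
    (SimpleGraph.cycleGraph N).Adj u v ↔
      u.val + 1 = v.val ∨ v.val + 1 = u.val ∨ (u.val = 0 ∧ v.val + 1 = N) ∨ (v.val = 0 ∧ u.val + 1 = N) := by
  rw [SimpleGraph.cycleGraph_adj']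
  have hu := u.isLt
  have hv := v.isLt
  have h1 : (u - v).val = (if v ≤ u then u.val - v.val else N + u.val - v.val) := by
    split_ifs with h
    · exact Fin.coe_sub_iff_le.2 h
    · exact Fin.coe_sub_iff_lt.2 (not_le.1 h)
  have h2 : (v - u).val = (if u ≤ v then v.val - u.val else N + v.val - u.val) := by
    split_ifs with h
    · exact Fin.coe_sub_iff_le.2 h
    · exact Fin.coe_sub_iff_lt.2 (not_le.1 h)
  rw [h1, h2]
  split_ifs with ha hb hb <;> simp only [Fin.le_def, not_le] at ha hb <;> omega

/-- The cycle `C_N`, `N ≥ 4`, is triangle-free. [this work] -/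
theorem cycleGraph_cliqueFree_three {N : ℕ} (hN : 4 ≤ N) : (SimpleGraph.cycleGraph N).CliqueFree 3 := by
  classical
  intro t ht
  obtain ⟨a, b, c, hab, hac, hbc, -⟩ := SimpleGraph.is3Clique_iff.1 ht
  rw [cycleGraph_adj_iff_val_succ (by omega)] at hab hac hbc
  omega

/-- Gen 70's conditioned set `oddCond k = {3, 5, …, 2k+1}` of the odd cycle `C_{2k+3}` is layered: the odd vertices `≥ 3` are pairwise
non-adjacent, and the typed vertices (the even vertices `2, …, 2k+2`) are pairwise non-adjacent (the only edge between even labels is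
the closing edge `{0, 2k+2}`, and `0` has no neighbour in the set). [this work] -/
theorem layered_oddCond (k : ℕ) : Layered (SimpleGraph.cycleGraph (2 * k + 3)) (oddCond k) := by
  have hN : 3 ≤ 2 * k + 3 := by omega
  refine ⟨fun u hu v hv huv => ?_, fun u v hu hv ⟨a, ha, hau⟩ ⟨b, hb, hbv⟩ huv => ?_⟩
  · simp only [oddCond, Finset.mem_filter, Finset.mem_univ, true_and] at hu hv
    rw [cycleGraph_adj_iff_val_succ hN] at huv
    omega
  · simp only [oddCond, Finset.mem_filter, Finset.mem_univ, true_and, not_and, not_le] at hu hv ha hb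
    rw [cycleGraph_adj_iff_val_succ hN] at huv hau hbv
    have hu' := u.isLt
    have hv' := v.isLt
    have ha' := a.isLt
    have hb' := b.isLt
    omega

/-- **`LayeredTermWeighted` implies gen 70's typed target `OddCycleTermWeighted`** (hence, by `safe_edgeCore_cycleGraph_of_termWeighted`,
that every cycle `C_n`, `n ≥ 5`, has an A-safe core). [this work] -/
theorem oddCycleTermWeighted_of_layered (h : LayeredTermWeighted) : OddCycleTermWeighted :=
  fun k _ => h _ _ _ (cycleGraph_cliqueFree_three (by omega)) (layered_oddCond k)

/-- In particular gen 70's target already contains the SINGLE-VERTEX conditioning of the odd cycle (the term data is just the set of rows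
containing the vertex `3`; free structure: the path `4 – 5 – ⋯ – (2k+2) – 0 – 1 – 2` with its two ends typed). [this work] -/
theorem termWeightedIneq_singleton_of_oddCycleTermWeighted (h : OddCycleTermWeighted) (k : ℕ) (hk : 1 ≤ k) :
    TermWeightedIneq (SimpleGraph.cycleGraph (2 * k + 3)) {⟨3, by omega⟩} :=
  termWeightedIneq_anti _ (Finset.singleton_subset_iff.2 (by simp [oddCond])) (h k hk)

end Bridge

end Summit.CriticalPhenomena.PercolationContinuityZ3.Theorems.SunflowerPartition
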